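import Literature.Computability.Cryptography.RegevSamplerGeometry
import Literature.Computability.Cryptography.RegevSamplerWords
import HarnessLib

/-!
# Regev 2009, Lemma 3.14 in machine form: the register sizes of the branch and of the oracle's answer

Topic `Computability/Cryptography` (family `pqc`), grouping namespace `Regev2009.SamplerBounds`; sequel of
`RegevSamplerArith.lean` (the integer maps of the sampler's classical stage: the branch `ỹ = x̃ − latPart x̃`
of a grid point — its position inside the cell of `L*/R` —, the quotients `m = ⌊a⌋ / R` whose negatives are
the `CVP` oracle's answer coefficients, `recover_ytil`) and `RegevSamplerRegs.lean` (the register hypotheses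
of the measured-law bound ask that `ỹ` fit the `ℓ_Y`-bit point register and `−m` the `b_c`-bit answer
zone: hypotheses `hyr`, `hmr` of `regHyps` / `law_bound_machine`). Regev 2009 (J. ACM 56, art. 34;
arXiv:2401.03703, Lemma 3.14 p. 20, §2 p. 11: "a lattice point can be represented using a polynomial
number of bits"): both quantities are bounded polynomially in the instance, so polynomially many wires
suffice. Here, for a lattice instance `I = L(B)`:

* `abs_ytil_le` — `|ỹᵢ| ≤ |det B| · Σⱼ ‖b∨ⱼ‖` (the branch is `D·fract_{e}(x̃/D)` and `‖fract‖ ≤ Σ‖eⱼ‖`);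
* `mVec_eq_floor` — `mⱼ = ⌊⟨bⱼ, x̃/D⟩⌋`; `abs_mVec_le` — `|mⱼ| ≤ ‖bⱼ‖·‖x̃/D‖ + 1`;
  `norm_gridPt_gridVec_le` — for a grid word of `ℓ`-bit cells `‖x̃/D‖ ≤ √n·2^ℓ/D`;
* **`ytil_mem`**, **`neg_mVec_mem`** — the two register hypotheses: `ỹᵢ ∈ [−2^{ℓ_Y−1}, 2^{ℓ_Y−1})` once
  `|det B|·Σ‖b∨ⱼ‖ < 2^{ℓ_Y−1}`, and `−mⱼ ∈ [−2^{b_c−1}, 2^{b_c−1})` once `‖bⱼ‖·√n·2^ℓ/D + 1 < 2^{b_c−1}`.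

Everything is proved; no definition, no named fact is introduced.

## References

* O. Regev, *On lattices, learning with errors, random linear codes, and cryptography*, J. ACM 56
  (2009), art. 34; author's version arXiv:2401.03703: Lemma 3.14 (proof, p. 20), §2 p. 11
  [Regev2009].
* D. Micciancio, S. Goldwasser, *Complexity of Lattice Problems*, Kluwer 2002, Ch. 1 §1.1 (the
  fundamental parallelepiped; Cramer's rule) [MicciancioGoldwasser2002].
-/

noncomputable section

namespace Literature.Computability.Cryptography

namespace Regev2009

namespace SamplerBounds

open Literature.Algebra.EuclideanLattices Literature.Algebra.EuclideanLattices.Regev2009 Peikert2009 Finset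
  SamplerArith SamplerWords Literature.Computability.QuantumComplexity.GaussianCells
open scoped InnerProductSpace

variable (I : LatticeInstance) [hZ : IsZLattice ℝ I.lattice]

omit hZ in
/-- A coordinate of a grid point: `(x̃/D)ᵢ = x̃ᵢ/D`. [folklore] -/
theorem gridPt_apply (R : ℕ) (x : Fin I.n → ℤ) (i : Fin I.n) : gridPt I R x i = ((Dg I R : ℝ))⁻¹ * (x i : ℝ) := by
  rw [gridPt, PiLp.smul_apply, smul_eq_mul, intVecToEuclidean_apply]

/-- **The branch is bounded**: `|ỹᵢ| ≤ |det B| · Σⱼ ‖b∨ⱼ‖`. [cite: Regev2009, Lemma 3.14 (proof), §2 p. 11]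
[cite: MicciancioGoldwasser2002, Ch. 1 §1.1] -/
theorem abs_ytil_le (x : Fin I.n → ℤ) (i : Fin I.n) : |(ytil I x i : ℝ)| ≤ (detA I : ℝ) * ∑ j, ‖dualVec I j‖ := by
  have hD : (Dg I 1 : ℝ) = detA I := by simp [Dg]
  have hD0 : (Dg I 1 : ℝ) ≠ 0 := by rw [hD]; exact_mod_cast detA_ne_zero (I := I)
  have h1 : (ytil I x i : ℝ) = (Dg I 1 : ℝ) * gridPt I 1 (ytil I x) i := by
    rw [gridPt_apply, ← mul_assoc, mul_inv_cancel₀ hD0, one_mul]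
  have hfr : gridPt I 1 (ytil I x) = ZSpan.fract (eB I 1) (gridPt I 1 x) := (fract_gridPt I 1 x).symm
  have hco : |gridPt I 1 (ytil I x) i| ≤ ‖gridPt I 1 (ytil I x)‖ := by
    simpa [Real.norm_eq_abs] using PiLp.norm_apply_le (gridPt I 1 (ytil I x)) i
  have hfl : ‖gridPt I 1 (ytil I x)‖ ≤ ∑ j, ‖dualVec I j‖ := by
    rw [hfr]
    refine (ZSpan.norm_fract_le (eB I 1) _).trans (le_of_eq (sum_congr rfl fun j _ => ?_))
    rw [eB_apply, Nat.cast_one, inv_one, one_smul]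
  rw [h1, abs_mul, hD, Nat.abs_cast]
  exact mul_le_mul_of_nonneg_left (hco.trans hfl) (Nat.cast_nonneg _)

/-- **The branch fits the point register**: `ỹᵢ ∈ [−2^{ℓ_Y−1}, 2^{ℓ_Y−1})` once `|det B|·Σⱼ‖b∨ⱼ‖ < 2^{ℓ_Y−1}`
(hypothesis `hyr` of the register hypotheses). [cite: Regev2009, Lemma 3.14 (proof), §2 p. 11] -/
theorem ytil_mem (x : Fin I.n → ℤ) (i : Fin I.n) {ℓY : ℕ} (h : (detA I : ℝ) * ∑ j, ‖dualVec I j‖ < 2 ^ (ℓY - 1)) :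
    -2 ^ (ℓY - 1) ≤ ytil I x i ∧ ytil I x i < 2 ^ (ℓY - 1) := by
  have hlt : |(ytil I x i : ℝ)| < (2 : ℝ) ^ (ℓY - 1) := (abs_ytil_le I x i).trans_lt h
  have hlt' : |ytil I x i| < 2 ^ (ℓY - 1) := by exact_mod_cast hlt
  exact ⟨by linarith [neg_abs_le (ytil I x i)], (le_abs_self _).trans_lt hlt'⟩

variable (R : ℕ) [NeZero R]

/-- **The quotients are floors**: `mⱼ = ⌊⟨bⱼ, x̃/D⟩⌋`. [cite: Regev2009, Lemma 3.14 (proof)] -/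
theorem mVec_eq_floor (x : Fin I.n → ℤ) (j : Fin I.n) : mVec I R x j = ⌊⟪I.vec j, gridPt I R x⟫_ℝ⌋ := by
  have hR : (R : ℝ) ≠ 0 := by exact_mod_cast NeZero.ne R
  show aVec I x j / (R : ℤ) = _
  rw [← floor_repr_gridPt I R x j, ← Int.floor_div_natCast, repr_eq, mul_div_cancel_left₀ _ hR]

/-- `|mⱼ| ≤ ‖bⱼ‖·‖x̃/D‖ + 1`. [cite: Regev2009, Lemma 3.14 (proof)] -/
theorem abs_mVec_le (x : Fin I.n → ℤ) (j : Fin I.n) : |(mVec I R x j : ℝ)| ≤ ‖I.vec j‖ * ‖gridPt I R x‖ + 1 := by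
  rw [mVec_eq_floor]
  have hin : |⟪I.vec j, gridPt I R x⟫_ℝ| ≤ ‖I.vec j‖ * ‖gridPt I R x‖ := abs_real_inner_le_norm _ _
  have h1 := Int.floor_le ⟪I.vec j, gridPt I R x⟫_ℝ
  have h2 := Int.lt_floor_add_one ⟪I.vec j, gridPt I R x⟫_ℝ
  rw [abs_le]
  constructor
  · linarith [neg_abs_le ⟪I.vec j, gridPt I R x⟫_ℝ]
  · linarith [le_abs_self ⟪I.vec j, gridPt I R x⟫_ℝ]

omit hZ [NeZero R] in
/-- **A grid word of `ℓ`-bit cells is short**: `‖x̃/D‖ ≤ √n · 2^ℓ / D`. [cite: Regev2009, §2 p. 11] -/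
theorem norm_gridPt_gridVec_le {ℓ : ℕ} (Y : Fin I.n → Fin ℓ → Bool) :
    ‖gridPt I R (gridVec I Y)‖ ≤ ((Dg I R : ℝ))⁻¹ * (Real.sqrt I.n * 2 ^ ℓ) := by
  rw [gridPt, norm_smul, Real.norm_eq_abs, abs_inv, Nat.abs_cast]
  refine mul_le_mul_of_nonneg_left ?_ (inv_nonneg.2 (Nat.cast_nonneg _))
  rw [norm_intVecToEuclidean, show Real.sqrt I.n * 2 ^ ℓ = Real.sqrt (I.n * (2 ^ ℓ) ^ 2) by
    rw [Real.sqrt_mul (Nat.cast_nonneg _), Real.sqrt_sq (by positivity)]]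
  refine Real.sqrt_le_sqrt ?_
  calc ∑ j, ((gridVec I Y j : ℤ) : ℝ) ^ 2 ≤ ∑ _j : Fin I.n, ((2 : ℝ) ^ ℓ) ^ 2 :=
        sum_le_sum fun j _ => by
          rw [← sq_abs]
          exact pow_le_pow_left₀ (abs_nonneg _) (by rw [gridVec]; exact abs_cellPt_le ℓ (Y j)) 2
    _ = I.n * ((2 : ℝ) ^ ℓ) ^ 2 := by rw [sum_const, card_univ, Fintype.card_fin, nsmul_eq_mul]

/-- **The answer coefficients fit the answer zone**: `−mⱼ ∈ [−2^{b_c−1}, 2^{b_c−1})` once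
`‖bⱼ‖·√n·2^ℓ/D + 1 < 2^{b_c−1}` (hypothesis `hmr` of the register hypotheses). [cite: Regev2009, Lemma 3.14 (proof), §2 p. 11] -/
theorem neg_mVec_mem {ℓ : ℕ} (Y : Fin I.n → Fin ℓ → Bool) (j : Fin I.n) {bc : ℕ}
    (h : ‖I.vec j‖ * (((Dg I R : ℝ))⁻¹ * (Real.sqrt I.n * 2 ^ ℓ)) + 1 < 2 ^ (bc - 1)) :
    -2 ^ (bc - 1) ≤ -mVec I R (gridVec I Y) j ∧ -mVec I R (gridVec I Y) j < 2 ^ (bc - 1) := by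
  have hle : |(mVec I R (gridVec I Y) j : ℝ)| ≤ ‖I.vec j‖ * (((Dg I R : ℝ))⁻¹ * (Real.sqrt I.n * 2 ^ ℓ)) + 1 :=
    (abs_mVec_le I R _ j).trans (by gcongr; exact norm_gridPt_gridVec_le I R Y)
  have hlt : |(mVec I R (gridVec I Y) j : ℝ)| < (2 : ℝ) ^ (bc - 1) := hle.trans_lt h
  have hlt' : |mVec I R (gridVec I Y) j| < 2 ^ (bc - 1) := by exact_mod_cast hlt
  exact ⟨by linarith [le_abs_self (mVec I R (gridVec I Y) j)], by linarith [neg_abs_le (mVec I R (gridVec I Y) j)]⟩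

end SamplerBounds

end Regev2009

end Literature.Computability.Cryptography

end
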